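import Summits.QuantumFields.YangMills.Theorems.BalabanUVNodesK0RecordFormatNamesDressed
import Summits.QuantumFields.YangMills.Theorems.BalabanUVNodesK0AxGaugeFlowRec
import Summits.QuantumFields.YangMills.Theorems.BalabanUVNodesPortU8IotaRow

/-!
# K0⁷ — RECORD-SIDE FORMAT NAMES, LEMMAS 15: ed.20's LEG-DRESSED ROOTED CHART AT `B = 0` — the VALUE half of road (R-a)'s D13♮ row
# (`recordDressPot … 0 = 0`, `expGauge F K 0 t = expGauge F K lam 0`, ★ `recordEmbJDressed … φ′ 0 = 0` and its `thetaFill` instance)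

Cell `ym-nodeO-ideate` ∕ `ym-balaban-port`, DEFINER seat `ym-nodeO-def-1` (gen 36); `--kind proof --supports stmt-QuantumFields-20541 --as helper`; count-neutral; THEOREMS ONLY, faces of
ed.20's names (`…K0RecordFormatNamesDressed`, ✓p817982) through ★ PTB-1∕◇ lens-1's ✓ `K0AxGaugeFlowRec.gaugeFlowMap_expGauge_zero` (p813470) and ★ PTB-1's ✓ `PortU8.recordEmbJ_zero` (IotaRow).
[I] = [Balaban1987RG1].

WHY.  Road (R-a) (★★★ director-ym №541; ◆ CRIT-1 g36 cut l.4985 (T3)) instantiates JOIN-T's k-step at the dressed chart `ι♮ n := recordEmbJDressed … (φ′ n)`; the k-step's row `hL` asks, per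
member, `ι♮ n 0 = 0 ∧ ContDiffAt ℝ 2 (ι♮ n) 0 ∧` the link.  The VALUE conjunct is bookkeeping at the flat point: the potential `recordDressPot φ′ B` is B-linear, hence `0` at `B = 0`; the flow at the zero
potential is the identity gauge (`expGauge F K 0 t = expGauge F K lam 0`, both `x ↦ exp 0`); the rooted chart vanishes at `0` (`recordEmbJ_zero`, standing range + `0 < θ.εbg`); and `gaugeFlowMap (expGauge lam 0) 0 = 0`.
The `ContDiffAt` conjunct (HypAn on `recordEmbJ` ∘ smooth flow) and the LINK (`fderiv ι♮ 0 (δ_l ⊗ bV a) = recordGkJ + recordGradLeg (φ′ l a)` ⟹ `= recordGkLocWξ univ` under `DressLink`) are (ra-3), ◇ lens-1 g10's file.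

WHAT THIS FILE IS (theorems only): `recordDressPot_zero` · `expGauge_zeroPot` · ★ `recordEmbJDressed_zero (hk) (hε)` · ★ `recordEmbJDressed_zero_thetaFill (ha₀ : 0 < a₀) (Mc k n) (φ′)` in JOIN-T's binder shape.

HONEST FRAMING.  Flat-point bookkeeping; NO estimate of Bałaban's; nothing asserted, ported or discharged beyond these `B = 0` faces; `DressLink`, (ra-1)(ra-3 link∕`ContDiffAt`)(ra-4), D1, (Tok-cmpU-cap), (C-tab-opt)∕(178)
mod P0, HypAn, ⟨26900⟩ OPEN; [E] inhabited unconditionally NOWHERE; 27931 CLOSED·IMPLICATION-ONLY·IN TOTO; 27930 ∕ 26648 OPEN; K0ᴬ ∕ K1ᴬ ∕ K3ᴬ OPEN; NODE O not inhabited (0∕1); COUNT 8∕28 · K 1∕4 UNMOVED;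
finite `𝕋⁴_{L^K}` at fixed ε — NOT continuum ∕ ℝ⁴ ∕ OS; **the Yang–Mills mass gap (Clay) is NOT proved by any of this.**  No `sorry`; standard axioms.
-/

noncomputable section

open scoped BigOperators Matrix.Norms.L2Operator

namespace Summit.QuantumFields.YangMills.Theorems.K0RecordFormatNames

open Literature.MathematicalPhysics.QuantumFieldTheory.Balaban1983to89
open Literature.MathematicalPhysics.QuantumFieldTheory.Balaban1983to89.Node00
open Literature.MathematicalPhysics.QuantumFieldTheory.Balaban1983to89.T4Continuum (T4Family)
open Summit.QuantumFields.YangMills.Theorems.K0AxGaugeFlowRec (gaugeGen expGauge gaugeFlowMap gaugeFlowMap_expGauge_zero coe_expGauge)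
open Summit.QuantumFields.YangMills.Theorems.PortU8 (recordEmbJ_zero)

variable (F : T4Family)

/-! ## §1  The zero potential and the identity flow -/

/-- The gauge generator of the ZERO potential vanishes. [cite: Balaban1987RG1, (4.8) p.283 (bookkeeping)] -/
theorem gaugeGen_zeroPot (K : ℕ) (x : Site (F.P K) 0) : gaugeGen F K 0 x = 0 := by
  simp [gaugeGen]

/-- **The flow of the ZERO potential at any time IS the time-zero flow** (both are the identity gauge `x ↦ exp 0`): `expGauge F K 0 t = expGauge F K lam 0`.
[cite: Balaban1987RG1, (4.8) p.283, (1.10) p.262 (bookkeeping)] -/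
theorem expGauge_zeroPot (K : ℕ) (t : ℝ) (lam : Site (F.P K) 0 → Fin 3 → ℂ) : expGauge F K 0 t = expGauge F K lam 0 := by
  apply Subtype.ext
  funext x
  apply Units.ext
  rw [coe_expGauge, coe_expGauge, gaugeGen_zeroPot, smul_zero, Complex.ofReal_zero, zero_smul]

section Theta

variable (θ : Stage13Params F 2)

/-! ## §2  The dressed chart at `B = 0` -/

/-- **`recordDressPot … φ′ 0 = 0`**: the B-linear dressing potential vanishes at `B = 0` (every `bV`-coordinate of `0` is `0`). [cite: Balaban1987RG1, (4.8) p.283 (bookkeeping)] -/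
theorem recordDressPot_zero (k K : ℕ) (φ' : RespLabel F k K → θ.ιβ → Site (F.P K) 0 → Fin 3 → ℂ) :
    (letI := θ.instVβ₁; letI := θ.instVβ₂; recordDressPot F θ k K φ' 0) = 0 := by
  letI := θ.instVβ₁; letI := θ.instVβ₂; letI := θ.instιβ
  funext x c
  simp [recordDressPot]

/-- ★ **`ι♮(0) = 0`**: the leg-dressed rooted chart vanishes at `B = 0` (standing range `k + 1 ≤ m + K`, `0 < θ.εbg`) — zero potential ⇒ identity flow; `recordEmbJ 0 = 0` (★ PTB-1); `gaugeFlowMap (expGauge · 0) 0 = 0`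
(★ PTB-1∕◇ lens-1).  The VALUE half of road (R-a)'s D13♮ row. [cite: Balaban1987RG1, (4.35) p.290, (4.8) p.283, (1.9) p.261 (bookkeeping)] -/
theorem recordEmbJDressed_zero (k K : ℕ) (hk : k + 1 ≤ (F.P K).m + (F.P K).K) (hε : 0 < θ.εbg)
    (φ' : RespLabel F k K → θ.ιβ → Site (F.P K) 0 → Fin 3 → ℂ) :
    (letI := θ.instVβ₁; letI := θ.instVβ₂; recordEmbJDressed F θ k K φ' 0) = 0 := by
  letI := θ.instVβ₁; letI := θ.instVβ₂
  show gaugeFlowMap F K (expGauge F K (recordDressPot F θ k K φ' 0) 1) (recordEmbJ F θ k K 0) = 0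
  rw [recordDressPot_zero, recordEmbJ_zero F θ k K hk hε, expGauge_zeroPot F K 1 0]
  exact gaugeFlowMap_expGauge_zero F K 0

/-- ★ **THE JOIN-T INSTANCE of the value conjunct under (R-a)**: at `θ := thetaFill F a₀ ε₂₉` (`εbg = a₀`) and the volumes `K := recordK₀ F Mc k + n`: for `0 < a₀`, every `k n` and every potential
family `φ′`, `recordEmbJDressed F (thetaFill F a₀ ε₂₉) k (recordK₀ F Mc k + n) φ′ 0 = 0`. [cite: Balaban1987RG1, (4.35) p.290, (1.21) p.264 (bookkeeping)] -/
theorem recordEmbJDressed_zero_thetaFill (a₀ ε₂₉ : ℝ) (ha₀ : 0 < a₀) (Mc k n : ℕ)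
    (φ' : RespLabel F k (recordK₀ F Mc k + n) → (thetaFill F a₀ ε₂₉).ιβ → Site (F.P (recordK₀ F Mc k + n)) 0 → Fin 3 → ℂ) :
    letI θ := thetaFill F a₀ ε₂₉; letI := θ.instVβ₁; letI := θ.instVβ₂;
    recordEmbJDressed F θ k (recordK₀ F Mc k + n) φ' 0 = 0 := by
  refine recordEmbJDressed_zero F (thetaFill F a₀ ε₂₉) k (recordK₀ F Mc k + n) ?_ ?_ φ'
  · simp only [T4Family.P_m, T4Family.P_K, recordK₀]
    omega
  · show 0 < a₀
    exact ha₀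

end Theta

end Summit.QuantumFields.YangMills.Theorems.K0RecordFormatNames

end
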